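import Summits.BirchSwinnertonDyer.Rank2.LevelFifteenRiemannSums
import Summits.BirchSwinnertonDyer.Rank2.RefFifteenTwoAdicLFunctionUnit
import Literature.NumberTheory.EllipticCurves.PAdicLFunctionRiemannSumCertificateProofs
import HarnessLib

/-!
# Manin symbols on `Γ₀(15)`, VI: the first coefficients of `L₂(15A8, α, T)` modulo `4` — the curve side of the
# BC5 rung «(★) mod T⁸» as THEOREMS about the tree's `padicLFunction`

Cell `bsd-rank2` (D-0036), seat `bsd-rank2-eng` GEN 9 (director-bsd g9 ruling (R3); line `star`, crux E1M
stmt-BirchSwinnertonDyer-20341; Stage B4). Inputs, all tree theorems: part V's closed form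
`RS(k,n) = s·α⁻ⁿ⁻³(α·A(k,n) + B(k,n))/4` with the kernel-evaluated tables at `n = 6`; the truncation bound
`norm_padicLCoeff_sub_padicLRiemannSum_le` (MSD distribution relation `msdMeasure_distribution_of_isNewformOf`, norm bound
`‖μ‖ ≤ 2` `norm_msdMeasure_two_le_two_auto`), giving `c_k ≡ RS(k,6) (mod 4ℤ₂)` for `k ≤ 5`; and the `2`-adic position
of the unit root: **`α ≡ 37 (mod 2⁷)`** (`(α − 37)(α + 38) = α² + α − 1406 = −2⁷·11`).

Result (`padicLCoeff_refFifteen_mod_four`): for every newform `f` of `[1,1,1,0,0]` and `α` its unit root at `2`,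
with `c_k` the `k`-th coefficient of `L₂(f, α, T)` and `s = ±1` the sign of part IV:
**`‖c_k/2 − s·b_k‖₂ ≤ 1/2` for `(k, b_k) = (0,1), (1,0), (2,0), (3,1), (4,1), (5,0)`** — i.e. `u = L₂/2` (a unit of `Λ`,
eng-2 GEN 4) satisfies **`ū ≡ 1 + T³ + T⁴ (mod 2, T⁶)`**, the left side of (★) for `15A8` up to the shift `T²` and the
depletion `𝒫₃𝒫₅`. Integer certificate: `16 ∣ 37·A(k,6) + B(k,6) − 8·37⁹·b_k` (`decide`).

THEOREMS ONLY (no definition, no named fact, no `sorry`). PARTITION: none — r_an ≥ 2, summit axis S0; TWIN (D-0056): n/a.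
B1 honesty: finite `2`-adic arithmetic on the tree's `L₂`; nothing here reads an analytic rank; no S0 motion.

References: B. Mazur, J. Tate, J. Teitelbaum, *Invent. Math.* 84 (1986) §I.10–§I.13 [MazurTateTeitelbaum1986Invent];
J. E. Cremona, *Algorithms for modular elliptic curves* (1997) §2.8 [CremonaAlgorithms1997].
-/

noncomputable section

open Filter Topology
open scoped MatrixGroups ModularForm

open CongruenceSubgroup Literature.NumberTheory.EllipticCurves Literature.NumberTheory.EllipticCurves.ModularForms

namespace Summit.BirchSwinnertonDyer.Rank2.LevelFifteen

/-! ### §1 The unit root of `X² + X + 2` sits at `37 mod 2⁷` -/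

/-- `‖2‖₂ = 1/2`. [folklore] -/
private theorem norm_two : ‖(2 : ℚ_[2])‖ = (2 : ℝ)⁻¹ := by
  have h := Padic.norm_p (p := 2); simpa using h

/-- **`‖α − 37‖₂ ≤ 2⁻⁷`** for any `α ∈ ℚ₂` with `‖α‖ = 1` and `α² + α + 2 = 0`: `(α − 37)(α + 38) = −1408 = −2⁷·11` and
`‖α + 38‖ = 1`. [folklore] -/
theorem norm_sub_thirtySeven_le {α : ℚ_[2]} (hαu : ‖α‖ = 1) (hroot : α ^ 2 + α + 2 = 0) :
    ‖α - 37‖ ≤ (2 : ℝ)⁻¹ ^ 7 := by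
  have hprod : (α - 37) * (α + 38) = -(2 ^ 7 * 11) := by linear_combination hroot
  have h38 : ‖(38 : ℚ_[2])‖ < 1 := by
    rw [show (38 : ℚ_[2]) = ((38 : ℤ) : ℚ_[2]) by norm_num]
    exact (Padic.norm_intCast_lt_one_iff (p := 2)).mpr (by norm_num)
  have hsum : ‖α + 38‖ = 1 := by
    have hne : ‖α‖ ≠ ‖(38 : ℚ_[2])‖ := by rw [hαu]; exact (ne_of_gt h38)
    rw [Padic.add_eq_max_of_ne hne, hαu]
    exact max_eq_left h38.le
  have h11 : ‖(11 : ℚ_[2])‖ = 1 := by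
    rw [show (11 : ℚ_[2]) = ((11 : ℤ) : ℚ_[2]) by norm_num]
    refine le_antisymm (Padic.norm_int_le_one _) (not_lt.mp fun h ↦ ?_)
    have h2 : (2 : ℤ) ∣ 11 := by exact_mod_cast (Padic.norm_intCast_lt_one_iff (p := 2)).mp h
    omega
  have hn : ‖α - 37‖ * ‖α + 38‖ = (2 : ℝ)⁻¹ ^ 7 := by
    rw [← norm_mul, hprod, norm_neg, norm_mul, norm_pow, norm_two, h11, mul_one]
  rw [hsum, mul_one] at hn
  exact hn.le

/-- `‖αⁿ − 37ⁿ‖₂ ≤ 2⁻⁷` under the same hypotheses (`αⁿ − 37ⁿ = (Σ αⁱ37ⁿ⁻¹⁻ⁱ)(α − 37)`). [folklore] -/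
theorem norm_pow_sub_pow_thirtySeven_le {α : ℚ_[2]} (hαu : ‖α‖ = 1) (hroot : α ^ 2 + α + 2 = 0) (m : ℕ) :
    ‖α ^ m - 37 ^ m‖ ≤ (2 : ℝ)⁻¹ ^ 7 := by
  rw [← geom_sum₂_mul, norm_mul]
  have hgeom : ‖∑ i ∈ Finset.range m, α ^ i * (37 : ℚ_[2]) ^ (m - 1 - i)‖ ≤ 1 := by
    refine IsUltrametricDist.norm_sum_le_of_forall_le_of_nonneg zero_le_one fun i _ ↦ ?_
    rw [norm_mul, norm_pow, norm_pow, hαu, one_pow, one_mul]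
    have : ‖(37 : ℚ_[2])‖ ≤ 1 := by
      rw [show (37 : ℚ_[2]) = ((37 : ℤ) : ℚ_[2]) by norm_num]; exact Padic.norm_int_le_one _
    exact pow_le_one₀ (norm_nonneg _) this
  calc _ ≤ 1 * (2 : ℝ)⁻¹ ^ 7 := mul_le_mul hgeom (norm_sub_thirtySeven_le hαu hroot) (norm_nonneg _) zero_le_one
    _ = _ := one_mul _

/-! ### §2 The integer certificate -/

/-- `16 ∣ 37·A(k,6) + B(k,6) − 8·37⁹·b_k` for `(k, b_k) = (0,1), (1,0), (2,0), (3,1), (4,1), (5,0)`. [folklore] -/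
theorem cert_mod_sixteen :
    (16 : ℤ) ∣ 37 * riemannA 0 6 + riemannB 0 6 - 8 * 37 ^ 9 * 1 ∧
    (16 : ℤ) ∣ 37 * riemannA 1 6 + riemannB 1 6 - 8 * 37 ^ 9 * 0 ∧
    (16 : ℤ) ∣ 37 * riemannA 2 6 + riemannB 2 6 - 8 * 37 ^ 9 * 0 ∧
    (16 : ℤ) ∣ 37 * riemannA 3 6 + riemannB 3 6 - 8 * 37 ^ 9 * 1 ∧
    (16 : ℤ) ∣ 37 * riemannA 4 6 + riemannB 4 6 - 8 * 37 ^ 9 * 1 ∧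
    (16 : ℤ) ∣ 37 * riemannA 5 6 + riemannB 5 6 - 8 * 37 ^ 9 * 0 := by
  obtain ⟨a0, b0, a1, b1, a2, b2, a3, b3, a4, b4, a5, b5⟩ := riemann_tables_six
  rw [a0, b0, a1, b1, a2, b2, a3, b3, a4, b4, a5, b5]
  norm_num

/-! ### §3 `c_k ≡ RS(k, 6) (mod 4)` and the bits of `u = L₂/2` -/

/-- **The generic step.** If `‖c − R‖ ≤ 1/4`, `R = s·α⁻⁹(αA + B)/4`, `s = ±1`, `‖α‖ = 1`, `α² + α + 2 = 0` and
`16 ∣ 37A + B − 8·37⁹·b`, then `‖c/2 − s·b‖ ≤ 1/2`. [cite: MazurTateTeitelbaum1986Invent, §I.13] -/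
theorem norm_half_sub_bit_le {α c R : ℚ_[2]} {σ A B b : ℤ} (hαu : ‖α‖ = 1) (hroot : α ^ 2 + α + 2 = 0)
    (hσ : σ = 1 ∨ σ = -1) (hR : R = (σ : ℚ_[2]) * α⁻¹ ^ 9 * ((α * A + B) / 4))
    (herr : ‖c - R‖ ≤ (2 : ℝ)⁻¹ ^ 2) (hcert : (16 : ℤ) ∣ 37 * A + B - 8 * 37 ^ 9 * b) :
    ‖c / 2 - σ * b‖ ≤ (2 : ℝ)⁻¹ := by
  have hα0 : α ≠ 0 := by rintro rfl; norm_num at hroot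
  have hαi : ‖α⁻¹‖ = 1 := by rw [norm_inv, hαu, inv_one]
  -- the key quantity `Q = αA + B − 8α⁹b` has norm ≤ 2⁻⁴
  obtain ⟨q, hq⟩ := hcert
  have hQ : ‖α * A + B - 8 * α ^ 9 * b‖ ≤ (2 : ℝ)⁻¹ ^ 4 := by
    have hsplit : α * (A : ℚ_[2]) + B - 8 * α ^ 9 * b =
        16 * (q : ℚ_[2]) + (α - 37) * A + -(8 * (b : ℚ_[2]) * (α ^ 9 - 37 ^ 9)) := by
      have hq' : (37 : ℚ_[2]) * A + B - 8 * 37 ^ 9 * b = 16 * q := by exact_mod_cast hq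
      linear_combination hq'
    rw [hsplit]
    have h1 : ‖(16 : ℚ_[2]) * q‖ ≤ (2 : ℝ)⁻¹ ^ 4 := by
      rw [norm_mul, show (16 : ℚ_[2]) = 2 ^ 4 by norm_num, norm_pow, norm_two]
      calc ((2 : ℝ)⁻¹) ^ 4 * ‖(q : ℚ_[2])‖ ≤ ((2 : ℝ)⁻¹) ^ 4 * 1 := by
            gcongr; exact Padic.norm_int_le_one q
        _ = _ := mul_one _
    have h2 : ‖(α - 37) * (A : ℚ_[2])‖ ≤ (2 : ℝ)⁻¹ ^ 4 := by
      rw [norm_mul]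
      calc ‖α - 37‖ * ‖(A : ℚ_[2])‖ ≤ (2 : ℝ)⁻¹ ^ 7 * 1 :=
            mul_le_mul (norm_sub_thirtySeven_le hαu hroot) (Padic.norm_int_le_one A) (norm_nonneg _) (by positivity)
        _ ≤ (2 : ℝ)⁻¹ ^ 4 := by norm_num
    have h3 : ‖-((8 : ℚ_[2]) * (b : ℚ_[2]) * (α ^ 9 - 37 ^ 9))‖ ≤ (2 : ℝ)⁻¹ ^ 4 := by
      rw [norm_neg, norm_mul, norm_mul]
      have h8 : ‖(8 : ℚ_[2])‖ ≤ 1 := by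
        rw [show (8 : ℚ_[2]) = ((8 : ℤ) : ℚ_[2]) by norm_num]; exact Padic.norm_int_le_one _
      have hb : ‖(b : ℚ_[2])‖ ≤ 1 := Padic.norm_int_le_one b
      have h8b : ‖(8 : ℚ_[2])‖ * ‖(b : ℚ_[2])‖ ≤ 1 := by
        calc ‖(8 : ℚ_[2])‖ * ‖(b : ℚ_[2])‖ ≤ 1 * 1 := mul_le_mul h8 hb (norm_nonneg _) zero_le_one
          _ = 1 := one_mul _
      calc ‖(8 : ℚ_[2])‖ * ‖(b : ℚ_[2])‖ * ‖α ^ 9 - 37 ^ 9‖ ≤ 1 * (2 : ℝ)⁻¹ ^ 7 :=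
            mul_le_mul h8b (norm_pow_sub_pow_thirtySeven_le hαu hroot 9) (norm_nonneg _) zero_le_one
        _ ≤ (2 : ℝ)⁻¹ ^ 4 := by norm_num
    refine (IsUltrametricDist.norm_add_le_max _ _).trans (max_le ?_ h3)
    exact (IsUltrametricDist.norm_add_le_max _ _).trans (max_le h1 h2)
  -- `R/2 − s b = s α⁻⁹ Q / 8`
  have hσu : ‖(σ : ℚ_[2])‖ = 1 := by
    rcases hσ with rfl | rfl <;> simp
  have hσ2 : (σ : ℚ_[2]) * σ = 1 := by
    rcases hσ with rfl | rfl <;> norm_num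
  have hRb : R / 2 - σ * b = (σ : ℚ_[2]) * α⁻¹ ^ 9 * (α * A + B - 8 * α ^ 9 * b) / 8 := by
    rw [hR]
    have hαpow : α⁻¹ ^ 9 * α ^ 9 = 1 := by rw [← mul_pow, inv_mul_cancel₀ hα0, one_pow]
    linear_combination ((σ : ℚ_[2]) * b) * hαpow
  have hRb' : ‖R / 2 - σ * b‖ ≤ (2 : ℝ)⁻¹ := by
    rw [hRb, norm_div, norm_mul, norm_mul, hσu, norm_pow, hαi, one_pow, one_mul, one_mul,
      show (8 : ℚ_[2]) = 2 ^ 3 by norm_num, norm_pow, norm_two]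
    rw [div_le_iff₀ (by positivity)]
    calc ‖α * ↑A + ↑B - 8 * α ^ 9 * ↑b‖ ≤ (2 : ℝ)⁻¹ ^ 4 := hQ
      _ = 2⁻¹ * (2⁻¹) ^ 3 := by ring
  -- `c/2 − s b = (c − R)/2 + (R/2 − s b)`
  have hsplit : c / 2 - σ * b = (c - R) / 2 + (R / 2 - σ * b) := by ring
  rw [hsplit]
  refine (IsUltrametricDist.norm_add_le_max _ _).trans (max_le ?_ hRb')
  rw [norm_div, norm_two, div_le_iff₀ (by positivity)]
  calc ‖c - R‖ ≤ (2 : ℝ)⁻¹ ^ 2 := herr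
    _ ≤ 2⁻¹ * 2⁻¹ := by norm_num

/-- **The first six coefficients of `L₂(15A8, α, T)` modulo `4`.** For every newform `f` of `[1,1,1,0,0]` (with its
globally minimal structure `hmin`), `α = unitRoot` at `2`, `c_k = padicLCoeff f α k` and the sign `s = ±1` of part IV
(`[0]⁺_f = −s/8`): `‖c_k/2 − s·b_k‖₂ ≤ 1/2` for `(k, b_k) = (0,1),(1,0),(2,0),(3,1),(4,1),(5,0)` — i.e. `u = L₂/2` reduces to
`1 + T³ + T⁴ (mod 2, T⁶)`. [cite: MazurTateTeitelbaum1986Invent, §I.10–§I.13] -/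
theorem padicLCoeff_refFifteen_mod_four (hmin : (⟨1, 1, 1, 0, 0⟩ : WeierstrassCurve ℚ).IsGloballyMinimal)
    ⦃N : ℕ⦄ [NeZero N] (f : CuspForm (Gamma0 N) 2) (hW : IsNewformOf (⟨1, 1, 1, 0, 0⟩ : WeierstrassCurve ℚ) f) :
    ∃ σ : ℤ, (σ = 1 ∨ σ = -1) ∧ ratPlusSymbol f 0 = -(σ : ℚ) / 8 ∧
      ∀ kb ∈ [((0 : ℕ), (1 : ℤ)), (1, 0), (2, 0), (3, 1), (4, 1), (5, 0)],
        ‖padicLCoeff f (@unitRoot (⟨1, 1, 1, 0, 0⟩ : WeierstrassCurve ℚ) hmin 2 _ : ℚ_[2]) kb.1 / 2 -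
            σ * kb.2‖ ≤ (2 : ℝ)⁻¹ := by
  haveI : (⟨1, 1, 1, 0, 0⟩ : WeierstrassCurve ℚ).IsElliptic := refFifteen_isElliptic
  haveI := hmin
  -- pin the level: `N = 15`
  have hsq : Squarefree ((⟨1, 1, 1, 0, 0⟩ : WeierstrassCurve ℚ).conductorNorm ℤ) := by
    rw [refFifteen_conductorNorm, show (15 : ℕ) = 3 * 5 by norm_num, Nat.squarefree_mul (by norm_num)]
    exact ⟨Nat.prime_three.prime.squarefree, Nat.prime_five.prime.squarefree⟩
  have hN : N = 15 := (hW.level_eq_conductorNorm_of_squarefree hsq).trans refFifteen_conductorNorm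
  subst hN
  set α : ℚ_[2] := (@unitRoot (⟨1, 1, 1, 0, 0⟩ : WeierstrassCurve ℚ) hmin 2 _ : ℚ_[2]) with hαdef
  have hord := refFifteen_isOrdinaryAt_two hmin
  obtain ⟨hαeq, hαu, hα0⟩ := unitRoot_coe_spec (W := (⟨1, 1, 1, 0, 0⟩ : WeierstrassCurve ℚ)) hord
  have ha₂ : (⟨1, 1, 1, 0, 0⟩ : WeierstrassCurve ℚ).frobeniusTrace 2 = -1 :=
    SymbolParityAtTwo.refFifteen_frobeniusTrace_two hmin
  have hroot : α ^ 2 + α + 2 = 0 := by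
    rw [ha₂] at hαeq; push_cast at hαeq; rw [hαdef]; linear_combination hαeq
  have hroot' : α ^ 2 - ((-1 : ℤ) : ℚ_[2]) * α + 2 = 0 := by push_cast; linear_combination hroot
  -- the Riemann sums in closed form (part V)
  obtain ⟨σ, hσ, h0, hRS⟩ := padicLRiemannSum_refFifteen_eq f hW
  refine ⟨σ, hσ, h0, ?_⟩
  -- the truncation bound with `C = 2`, `n = 6`
  have hreal : ∀ n, (cuspCoeff f n).im = 0 := cuspCoeff_im_eq_zero_of_coeffField_eq_bot hW.coeffField_eq_bot
  have hcusp : cuspCoeff f 2 = ((-1 : ℤ) : ℂ) := by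
    rw [cuspCoeff_eq_frobeniusTrace_of_isNewformOf_holds hW hord.1, ha₂]
  have hαi : ‖α⁻¹‖ ≤ 1 := by rw [norm_inv, hαu, inv_one]
  have hC := norm_msdMeasure_two_le_two_auto hW.1 hreal (by norm_num : ¬ 2 ∣ 15) hcusp hαi hroot'
  have hdist := msdMeasure_distribution_of_isNewformOf (W := (⟨1, 1, 1, 0, 0⟩ : WeierstrassCurve ℚ)) hord hW
  have herr : ∀ k : ℕ, k ≤ 5 → ‖padicLCoeff f α k - padicLRiemannSum f α k 6‖ ≤ (2 : ℝ)⁻¹ ^ 2 := by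
    intro k hk
    have h := norm_padicLCoeff_sub_padicLRiemannSum_le (p := 2) (f := f) (α := α) hdist zero_le_two hC k 6
    refine h.trans ?_
    -- `2 / ‖k!‖ · 2⁻⁶ ≤ 1/4` since `v₂(k!) ≤ 3` for `k ≤ 5`
    have hfac : (2 : ℝ)⁻¹ ^ 3 ≤ ‖((k.factorial : ℕ) : ℚ_[2])‖ := by
      interval_cases k
      · norm_num [Nat.factorial]
      · norm_num [Nat.factorial]
      · rw [show ((Nat.factorial 2 : ℕ) : ℚ_[2]) = 2 by norm_num [Nat.factorial], norm_two]; norm_num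
      · rw [show ((Nat.factorial 3 : ℕ) : ℚ_[2]) = 2 * 3 by norm_num [Nat.factorial], norm_mul, norm_two,
          show (3 : ℚ_[2]) = ((3 : ℤ) : ℚ_[2]) by norm_num]
        have : ‖((3 : ℤ) : ℚ_[2])‖ = 1 := le_antisymm (Padic.norm_int_le_one _) (not_lt.mp fun h ↦ by
          have h2 : (2 : ℤ) ∣ 3 := by exact_mod_cast (Padic.norm_intCast_lt_one_iff (p := 2)).mp h
          omega)
        rw [this]; norm_num
      · rw [show ((Nat.factorial 4 : ℕ) : ℚ_[2]) = 2 ^ 3 * 3 by norm_num [Nat.factorial], norm_mul, norm_pow,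
          norm_two, show (3 : ℚ_[2]) = ((3 : ℤ) : ℚ_[2]) by norm_num]
        have : ‖((3 : ℤ) : ℚ_[2])‖ = 1 := le_antisymm (Padic.norm_int_le_one _) (not_lt.mp fun h ↦ by
          have h2 : (2 : ℤ) ∣ 3 := by exact_mod_cast (Padic.norm_intCast_lt_one_iff (p := 2)).mp h
          omega)
        rw [this]; norm_num
      · rw [show ((Nat.factorial 5 : ℕ) : ℚ_[2]) = 2 ^ 3 * 15 by norm_num [Nat.factorial], norm_mul, norm_pow,
          norm_two, show (15 : ℚ_[2]) = ((15 : ℤ) : ℚ_[2]) by norm_num]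
        have : ‖((15 : ℤ) : ℚ_[2])‖ = 1 := le_antisymm (Padic.norm_int_le_one _) (not_lt.mp fun h ↦ by
          have h2 : (2 : ℤ) ∣ 15 := by exact_mod_cast (Padic.norm_intCast_lt_one_iff (p := 2)).mp h
          omega)
        rw [this]; norm_num
    have hpos : (0 : ℝ) < ‖((k.factorial : ℕ) : ℚ_[2])‖ := lt_of_lt_of_le (by positivity) hfac
    rw [show ((2 : ℕ) : ℝ) ^ (-(6 : ℕ) : ℤ) = (2 : ℝ)⁻¹ ^ 6 by
      rw [zpow_neg, zpow_natCast, inv_pow]; norm_num]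
    calc 2 / ‖((k.factorial : ℕ) : ℚ_[2])‖ * (2 : ℝ)⁻¹ ^ 6
        ≤ 2 / (2 : ℝ)⁻¹ ^ 3 * (2 : ℝ)⁻¹ ^ 6 := by gcongr
      _ = (2 : ℝ)⁻¹ ^ 2 := by norm_num
  -- the six bits
  obtain ⟨c0, c1, c2, c3, c4, c5⟩ := cert_mod_sixteen
  intro kb hkb
  simp only [List.mem_cons, List.mem_nil_iff, or_false] at hkb
  rcases hkb with rfl | rfl | rfl | rfl | rfl | rfl
  · exact norm_half_sub_bit_le hαu hroot hσ (hRS α hα0 0 6) (herr 0 (by norm_num)) (by simpa using c0)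
  · exact norm_half_sub_bit_le hαu hroot hσ (hRS α hα0 1 6) (herr 1 (by norm_num)) (by simpa using c1)
  · exact norm_half_sub_bit_le hαu hroot hσ (hRS α hα0 2 6) (herr 2 (by norm_num)) (by simpa using c2)
  · exact norm_half_sub_bit_le hαu hroot hσ (hRS α hα0 3 6) (herr 3 (by norm_num)) (by simpa using c3)
  · exact norm_half_sub_bit_le hαu hroot hσ (hRS α hα0 4 6) (herr 4 (by norm_num)) (by simpa using c4)
  · exact norm_half_sub_bit_le hαu hroot hσ (hRS α hα0 5 6) (herr 5 (by norm_num)) (by simpa using c5)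

end Summit.BirchSwinnertonDyer.Rank2.LevelFifteen

end
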